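import Summits.BirchSwinnertonDyer.BirchSwinnertonDyer.Theorems.AlignedTransportAtTwoMainConjectureTransportAlignedAtTwoKilfordStratum
import HarnessLib

/-!
# Route `AlignedTransportAtTwo`, crux C1 `MainConjectureTransportAlignedAtTwo` (stmt-BirchSwinnertonDyer-22296), line `birth`:
# the Kilford stratum is a property of the SHARED cubic field; the decidable form `Δ_min ≡ 1 (mod 8)`; two-curve consequences

Cell `bsd-f1-sign2`, WIDTH-5 attach seat `bsd-line-att-p4` g11 (`--supports stmt-BirchSwinnertonDyer-22296`). THEOREMS ONLY
(no `def`, no named fact, no `sorry`). Companion of `…KilfordStratum` (the one-curve dictionary). BSD is not proved by this; C1 is not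
closed by this.

* §4 `onKilfordStratumAtTwo_iff_of_sharedCubicField` — under the crux binder (no rational `2`-torsion abscissa on either curve, a cubic
  number field `F` with roots `e₁, e₂` of the two `u`-cubics) `OnKilfordStratumAtTwo W₁ ↔ OnKilfordStratumAtTwo W₂`, with NO reduction
  hypothesis; in fact (`splits_map_of_splits_map_of_sharedCubicField`) splitting over ANY field `K ⊇ ℚ` transfers: three roots of
  `c_{W₁} = minpoly(e₁)` in `K` give three embeddings `F → K` (power-basis lift), pairwise distinct on `e₂` as well (`F = ℚ(e₂)`), i.e.
  three roots of `c_{W₂}`. This is the kernel form of «the stratum depends only on `ρ̄_{E,2}`» (docstring of `F1Sign2.OnKilfordStratumAtTwo`).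
* §5 `isSquare_padic_two_intCast_iff_emod_eight` — an odd integer is a square in `ℚ₂` iff it is `≡ 1 (mod 8)` (easy half here via
  `toZModPow 3`; hard half = the tree's `padic_isSquare_intCast_of_mod_eight`); hence the DECIDABLE dictionary
  `onKilfordStratumAtTwo_iff_minimalDiscriminantInt_emod_eight : OnKilfordStratumAtTwo W ↔ Δ_min(W) % 8 = 1` for `W` good ordinary at `2`
  (so OFF the stratum ⟺ `Δ_min ≡ 3, 5, 7 (mod 8)`; cell `bsd-wall`'s plus-line engine `…RPlusLineThreeFacts` ran on `Δ_min ≡ 5 (mod 8)`).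
* §6 two-curve forms for the crux's pairs: `forall_sq_ne_of_sharedCubicField` (the line's `hΔ₂` passes from `W₁` to a good-ordinary `W₂`),
  `isSquare_padic_Δ_iff_of_sharedCubicField`, `minimalDiscriminantInt_emod_eight_eq_one_iff_of_sharedCubicField` (census-checkable:
  `Δ_min(W₁) ≡ 1 (8) ↔ Δ_min(W₂) ≡ 1 (8)` on aligned good-ordinary `S₃` pairs).

References: Serre, Cours d'arithmétique II.3.3 Thm 4 [Serre1973]; Silverman AEC III.1, VII.2 [SilvermanAEC2009]; Kilford–Wiese,
Exp. Math. 17 (2008) [KilfordWiese2008].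
-/

set_option autoImplicit false
-- justification: the `Summit.BirchSwinnertonDyer.BirchSwinnertonDyer.…` path repeats a component (route-file convention)
set_option linter.dupNamespace false

noncomputable section

open scoped Classical

open Polynomial WeierstrassCurve NumberField
open Literature.NumberTheory.EllipticCurves Literature.NumberTheory.EllipticCurves.Greenberg1999
open Summit.BirchSwinnertonDyer.Rank1Residual.F1Sign2
open Summit.BirchSwinnertonDyer.BirchSwinnertonDyer.Theorems.AlignedTransportAtTwoBridge
open Summit.BirchSwinnertonDyer.BirchSwinnertonDyer.Theorems.AlignedTransportAtTwoSharedCubicField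
open Summit.BirchSwinnertonDyer.BirchSwinnertonDyer.Theorems.AlignedTransportAtTwoKilfordStratum

namespace Summit.BirchSwinnertonDyer.BirchSwinnertonDyer.Theorems.AlignedTransportAtTwoKilfordStratumShared

/-! ## §4 The stratum is a property of the SHARED cubic field -/

section Shared

variable (W₁ W₂ : WeierstrassCurve ℚ) {F : Type} [Field F] [NumberField F] {K : Type*} [Field K] [CharZero K]

/-- **Splitting over `K` transfers across a shared cubic field.** Let `W₁, W₂/ℚ` have no rational `2`-torsion abscissa,
let `F` be a number field of degree `3` containing a root `e₁` of `c_{W₁}` and a root `e₂` of `c_{W₂}` (the crux binder),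
and let `K ⊇ ℚ` be any field. If `c_{W₁}` splits over `K` then so does `c_{W₂}`: the three roots `r₀, r₁, r₂ ∈ K` of
`c_{W₁} = minpoly_ℚ(e₁)` give three embeddings `σᵢ : F = ℚ(e₁) → K` (power-basis lift), pairwise distinct, hence —
as `F = ℚ(e₂)` too — three pairwise distinct roots `σᵢ(e₂)` of `c_{W₂}` in `K`. (The stratum depends only on the
common `ρ̄`, i.e. on `F ⊗ ℚ₂`.) [folklore] -/
theorem splits_map_of_splits_map_of_sharedCubicField (hF : Module.finrank ℚ F = 3)
    (ht₁ : ∀ x : ℚ, ¬ HasRationalTwoTorsionX W₁ x) (ht₂ : ∀ x : ℚ, ¬ HasRationalTwoTorsionX W₂ x)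
    {e₁ e₂ : F} (he₁ : aeval e₁ (twoDivisionUCubic W₁) = 0) (he₂ : aeval e₂ (twoDivisionUCubic W₂) = 0)
    (h₁ : ((twoDivisionUCubic W₁).map (algebraMap ℚ K)).Splits) :
    ((twoDivisionUCubic W₂).map (algebraMap ℚ K)).Splits := by
  have hmin₁ := minpoly_eq_twoDivisionUCubic W₁ ht₁ he₁
  have hmin₂ := minpoly_eq_twoDivisionUCubic W₂ ht₂ he₂
  obtain ⟨pb₁, hgen₁, -⟩ := exists_powerBasis_gen_eq (natDegree_twoDivisionUCubic W₁) hF hmin₁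
  obtain ⟨pb₂, hgen₂, -⟩ := exists_powerBasis_gen_eq (natDegree_twoDivisionUCubic W₂) hF hmin₂
  have hne₁ : (twoDivisionUCubic W₁).map (algebraMap ℚ K) ≠ 0 := ((monic_twoDivisionUCubic W₁).map _).ne_zero
  have hne₂ : (twoDivisionUCubic W₂).map (algebraMap ℚ K) ≠ 0 := ((monic_twoDivisionUCubic W₂).map _).ne_zero
  -- three distinct roots of `c_{W₁}` in `K`
  have hcard : ((twoDivisionUCubic W₁).map (algebraMap ℚ K)).roots.card = 3 := by
    rw [splits_iff_card_roots.mp h₁, natDegree_map, natDegree_twoDivisionUCubic]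
  have hnd : ((twoDivisionUCubic W₁).map (algebraMap ℚ K)).roots.Nodup :=
    nodup_roots (irreducible_twoDivisionUCubic W₁ ht₁).separable.map
  obtain ⟨r₀, r₁, r₂, hr⟩ := Multiset.card_eq_three.mp hcard
  rw [hr] at hnd
  have h01 : r₀ ≠ r₁ := by
    intro h; rw [h] at hnd; simp at hnd
  have h02 : r₀ ≠ r₂ := by
    intro h; rw [h] at hnd; simp at hnd
  have h12 : r₁ ≠ r₂ := by
    intro h; rw [h] at hnd; simp at hnd
  -- the three embeddings `F → K`
  have hroot : ∀ r : K, r ∈ ((twoDivisionUCubic W₁).map (algebraMap ℚ K)).roots → aeval r (minpoly ℚ pb₁.gen) = 0 := by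
    intro r hr'
    rw [hgen₁, hmin₁]
    exact aeval_eq_zero_of_eval_map_eq_zero W₁ ((mem_roots hne₁).mp hr')
  have hm₀ : r₀ ∈ ((twoDivisionUCubic W₁).map (algebraMap ℚ K)).roots := by rw [hr]; simp
  have hm₁ : r₁ ∈ ((twoDivisionUCubic W₁).map (algebraMap ℚ K)).roots := by rw [hr]; simp
  have hm₂ : r₂ ∈ ((twoDivisionUCubic W₁).map (algebraMap ℚ K)).roots := by rw [hr]; simp
  set σ₀ : F →ₐ[ℚ] K := pb₁.lift r₀ (hroot r₀ hm₀) with hσ₀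
  set σ₁ : F →ₐ[ℚ] K := pb₁.lift r₁ (hroot r₁ hm₁) with hσ₁
  set σ₂ : F →ₐ[ℚ] K := pb₁.lift r₂ (hroot r₂ hm₂) with hσ₂
  have hσe₁ : σ₀ e₁ = r₀ ∧ σ₁ e₁ = r₁ ∧ σ₂ e₁ = r₂ := by
    refine ⟨?_, ?_, ?_⟩ <;> rw [← hgen₁] <;> exact pb₁.lift_gen _ _
  -- their values at `e₂` are roots of `c_{W₂}` …
  have hval : ∀ σ : F →ₐ[ℚ] K, σ e₂ ∈ ((twoDivisionUCubic W₂).map (algebraMap ℚ K)).roots := fun σ ↦ by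
    rw [mem_roots hne₂, IsRoot.def, eval_map, ← aeval_def, aeval_algHom_apply, he₂, map_zero]
  -- … and pairwise distinct (an embedding of `F = ℚ(e₂)` is determined by the image of `e₂`)
  have hinj : ∀ σ τ : F →ₐ[ℚ] K, σ e₂ = τ e₂ → σ e₁ = τ e₁ := fun σ τ h ↦ by
    have : σ = τ := pb₂.algHom_ext (by rw [hgen₂]; exact h)
    rw [this]
  have hs01 : σ₀ e₂ ≠ σ₁ e₂ := fun h ↦ h01 (by rw [← hσe₁.1, ← hσe₁.2.1]; exact hinj _ _ h)
  have hs02 : σ₀ e₂ ≠ σ₂ e₂ := fun h ↦ h02 (by rw [← hσe₁.1, ← hσe₁.2.2]; exact hinj _ _ h)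
  have hs12 : σ₁ e₂ ≠ σ₂ e₂ := fun h ↦ h12 (by rw [← hσe₁.2.1, ← hσe₁.2.2]; exact hinj _ _ h)
  -- so `c_{W₂}` has (at least, hence exactly) three roots in `K`
  have hsub : ({σ₀ e₂, σ₁ e₂, σ₂ e₂} : Multiset K) ≤ ((twoDivisionUCubic W₂).map (algebraMap ℚ K)).roots := by
    refine (Multiset.le_iff_subset ?_).mpr ?_
    · simp [hs01, hs02, hs12]
    · simp [Multiset.cons_subset, hval]
  have hle := Multiset.card_le_card hsub
  have h3 : Multiset.card ({σ₀ e₂, σ₁ e₂, σ₂ e₂} : Multiset K) = 3 := by simp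
  have hdeg : ((twoDivisionUCubic W₂).map (algebraMap ℚ K)).natDegree = 3 := by
    rw [natDegree_map, natDegree_twoDivisionUCubic]
  have hub := card_roots' ((twoDivisionUCubic W₂).map (algebraMap ℚ K))
  rw [splits_iff_card_roots]
  omega

/-- **The Kilford stratum is a property of the shared cubic field.** Under the crux binder (no rational `2`-torsion
abscissa on either curve, a cubic number field `F` with roots `e₁`, `e₂` of the two `u`-cubics):
`OnKilfordStratumAtTwo W₁ ↔ OnKilfordStratumAtTwo W₂` — both say that `2` splits completely in `F`. (No reduction
hypothesis; this is the sentence «the property depends only on `ρ̄_{E,2}`, so it is shared by mod-`2`-congruent curves»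
of the docstring of `F1Sign2.OnKilfordStratumAtTwo`, in kernel form.) [folklore] -/
theorem onKilfordStratumAtTwo_iff_of_sharedCubicField (hF : Module.finrank ℚ F = 3)
    (ht₁ : ∀ x : ℚ, ¬ HasRationalTwoTorsionX W₁ x) (ht₂ : ∀ x : ℚ, ¬ HasRationalTwoTorsionX W₂ x)
    {e₁ e₂ : F} (he₁ : aeval e₁ (twoDivisionUCubic W₁) = 0) (he₂ : aeval e₂ (twoDivisionUCubic W₂) = 0) :
    OnKilfordStratumAtTwo W₁ ↔ OnKilfordStratumAtTwo W₂ :=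
  ⟨splits_map_of_splits_map_of_sharedCubicField W₁ W₂ hF ht₁ ht₂ he₁ he₂,
    splits_map_of_splits_map_of_sharedCubicField W₂ W₁ hF ht₂ ht₁ he₂ he₁⟩

end Shared

/-! ## §5 Numeric criterion: on the good-ordinary locus the stratum is read off `Δ_min mod 8` -/

section Numeric

/-- The `2`-adic integers whose square is `0`, `1` or `4` modulo `8` — i.e. all of them. [folklore] -/
theorem mul_self_zmod_eight (a : ZMod (2 ^ 3)) : a * a = 0 ∨ a * a = 1 ∨ a * a = 4 := by
  revert a; decide

/-- **An odd integer that is a square in `ℚ₂` is `≡ 1 (mod 8)`** (Serre, Cours d'arithmétique II.3.3 Thm. 4: a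
`2`-adic unit is a square iff it is `≡ 1 (mod 8)`; this is the easy half: a square root `s` is a `2`-adic unit and
`s² mod 8 ∈ {0, 1, 4}` meets the odd residues only in `1`). [cite: Serre1973, Ch. II §3.3 Thm 4] -/
theorem emod_eight_eq_one_of_isSquare_padic_two {m : ℤ} (hm : Odd m) (h : IsSquare (m : ℚ_[2])) : m % 8 = 1 := by
  obtain ⟨s, hs⟩ := h
  have hm1 : ‖(m : ℚ_[2])‖ = 1 := by
    rw [Padic.norm_intCast_eq_one_iff]
    obtain ⟨k, hk⟩ := hm
    exact ⟨1, -k, by rw [hk]; ring⟩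
  have hs1 : ‖s‖ = 1 := by
    have h2 : ‖s‖ * ‖s‖ = 1 := by rw [← norm_mul, ← hs, hm1]
    have h0 : 0 ≤ ‖s‖ := norm_nonneg s
    nlinarith
  set u : ℤ_[2] := ⟨s, hs1.le⟩ with hu
  have huc : (u : ℚ_[2]) = s := rfl
  have hum : u * u = (m : ℤ_[2]) := by
    apply PadicInt.ext
    rw [PadicInt.coe_mul, PadicInt.coe_intCast, huc, ← hs]
  have h8 := congrArg (PadicInt.toZModPow 3) hum
  rw [map_mul, map_intCast] at h8
  have hodd := Int.odd_iff.mp hm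
  rcases mul_self_zmod_eight (PadicInt.toZModPow 3 u) with h0 | h1 | h4
  · exfalso
    rw [h8] at h0
    have hd := (ZMod.intCast_zmod_eq_zero_iff_dvd m (2 ^ 3)).mp h0
    norm_num at hd
    omega
  · rw [h8] at h1
    have h1' : ((m - 1 : ℤ) : ZMod (2 ^ 3)) = 0 := by push_cast; rw [h1, sub_self]
    have hd := (ZMod.intCast_zmod_eq_zero_iff_dvd (m - 1) (2 ^ 3)).mp h1'
    norm_num at hd
    omega
  · exfalso
    rw [h8] at h4
    have h4' : ((m - 4 : ℤ) : ZMod (2 ^ 3)) = 0 := by push_cast; rw [h4, sub_self]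
    have hd := (ZMod.intCast_zmod_eq_zero_iff_dvd (m - 4) (2 ^ 3)).mp h4'
    norm_num at hd
    omega

/-- **`2`-adic squares among odd integers**: an odd `m` is a square in `ℚ₂` iff `m ≡ 1 (mod 8)` (the hard half is
the tree's `padic_isSquare_intCast_of_mod_eight`, Hensel at `2`). [cite: Serre1973, Ch. II §3.3 Thm 4] -/
theorem isSquare_padic_two_intCast_iff_emod_eight {m : ℤ} (hm : Odd m) : IsSquare (m : ℚ_[2]) ↔ m % 8 = 1 :=
  ⟨emod_eight_eq_one_of_isSquare_padic_two hm,
    Literature.NumberTheory.QuadraticForms.padic_isSquare_intCast_of_mod_eight (p := 2) rfl⟩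

variable (W : WeierstrassCurve ℚ) [W.IsGloballyMinimal]

/-- `Δ(W)` in `ℚ₂` is the cast of the minimal discriminant. [folklore] -/
theorem ratCast_Δ_padic_eq_intCast_minimalDiscriminantInt :
    (W.Δ : ℚ_[2]) = ((minimalDiscriminantInt W : ℤ) : ℚ_[2]) := by
  rw [← cast_minimalDiscriminantInt, Rat.cast_intCast]

variable [W.IsElliptic]

/-- **DECIDABLE FORM OF THE DICTIONARY.** For `W/ℚ` globally minimal with good ORDINARY reduction at `2`:
`W` is ON the Kilford stratum iff `Δ_min(W) ≡ 1 (mod 8)` (good reduction at `2` makes `Δ_min` odd —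
`WeierstrassCurve.not_dvd_minimalDiscriminantInt_of_hasGoodReductionAtPrime` — and an odd integer is a `2`-adic square
iff it is `1 mod 8`). So OFF the stratum ⟺ `Δ_min ≡ 3, 5, 7 (mod 8)`; cell `bsd-wall`'s plus-line engine ran on the
sub-case `Δ_min ≡ 5 (mod 8)` (`…RPlusLineThreeFacts`). [cite: Serre1973, Ch. II §3.3 Thm 4] [cite: SilvermanAEC2009, III.1 and VII.2] -/
theorem onKilfordStratumAtTwo_iff_minimalDiscriminantInt_emod_eight (hord : IsOrdinaryAt W 2) :
    OnKilfordStratumAtTwo W ↔ minimalDiscriminantInt W % 8 = 1 := by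
  have hodd : Odd (minimalDiscriminantInt W) := by
    rcases Int.even_or_odd (minimalDiscriminantInt W) with h | h
    · exact absurd (even_iff_two_dvd.mp h)
        (by exact_mod_cast W.not_dvd_minimalDiscriminantInt_of_hasGoodReductionAtPrime 2 hord.1)
    · exact h
  rw [onKilfordStratumAtTwo_iff_isSquare_padic_Δ W hord, ratCast_Δ_padic_eq_intCast_minimalDiscriminantInt,
    isSquare_padic_two_intCast_iff_emod_eight hodd]

/-- **OFF the stratum, decidably**: for `W/ℚ` globally minimal with good ordinary reduction at `2`,
`¬ OnKilfordStratumAtTwo W ↔ Δ_min(W) % 8 ≠ 1` (equivalently `Δ_min ≡ 3, 5 or 7 (mod 8)`, `Δ_min` being odd).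
[cite: Serre1973, Ch. II §3.3 Thm 4] -/
theorem not_onKilfordStratumAtTwo_iff_minimalDiscriminantInt_emod_eight_ne (hord : IsOrdinaryAt W 2) :
    ¬ OnKilfordStratumAtTwo W ↔ minimalDiscriminantInt W % 8 ≠ 1 :=
  (onKilfordStratumAtTwo_iff_minimalDiscriminantInt_emod_eight W hord).not

end Numeric

/-! ## §6 Consequences for the crux's pairs -/

section Pairs

variable (W₁ W₂ : WeierstrassCurve ℚ) [W₂.IsElliptic] [W₂.IsGloballyMinimal] {F : Type} [Field F] [NumberField F]

/-- **`Δ ∉ ℚ₂²` transfers across the crux's shared cubic field.** For the pairs of crux C1 (no rational `2`-torsion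
abscissa on either curve; `F` cubic with roots `e₁, e₂` of the two `u`-cubics) with `W₂` good ordinary at `2`:
if `Δ(W₁)` is not a square in `ℚ₂` then neither is `Δ(W₂)` — `W₁` is off the stratum (§3, no hypothesis on `W₁`),
hence so is `W₂` (§4), hence `Δ(W₂) ∉ ℚ₂²` (§3, ordinary). This is the two-curve form of the local hypothesis of
the line's Buzzard road. [folklore] -/
theorem forall_sq_ne_of_sharedCubicField (hF : Module.finrank ℚ F = 3)
    (ht₁ : ∀ x : ℚ, ¬ HasRationalTwoTorsionX W₁ x) (ht₂ : ∀ x : ℚ, ¬ HasRationalTwoTorsionX W₂ x)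
    {e₁ e₂ : F} (he₁ : aeval e₁ (twoDivisionUCubic W₁) = 0) (he₂ : aeval e₂ (twoDivisionUCubic W₂) = 0)
    (hord₂ : IsOrdinaryAt W₂ 2) (hΔ₁ : ∀ s : ℚ_[2], s ^ 2 ≠ (W₁.Δ : ℚ_[2])) :
    ∀ s : ℚ_[2], s ^ 2 ≠ (W₂.Δ : ℚ_[2]) :=
  forall_sq_ne_of_not_onKilfordStratumAtTwo W₂ hord₂ fun h₂ ↦
    not_onKilfordStratumAtTwo_of_forall_sq_ne W₁ hΔ₁
      ((onKilfordStratumAtTwo_iff_of_sharedCubicField W₁ W₂ hF ht₁ ht₂ he₁ he₂).mpr h₂)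

variable [W₁.IsElliptic] [W₁.IsGloballyMinimal]

/-- **`Δ ∈ ℚ₂²` together** on the crux's good-ordinary pairs: with BOTH curves good ordinary at `2`,
`IsSquare (Δ(W₁) : ℚ₂) ↔ IsSquare (Δ(W₂) : ℚ₂)` (both say «ON the Kilford stratum», a property of `F`).
The `2`-adic analogue of the tree's `isSquare_Δ_iff_of_shared_cubic_field` (rational squares). [folklore] -/
theorem isSquare_padic_Δ_iff_of_sharedCubicField (hF : Module.finrank ℚ F = 3)
    (ht₁ : ∀ x : ℚ, ¬ HasRationalTwoTorsionX W₁ x) (ht₂ : ∀ x : ℚ, ¬ HasRationalTwoTorsionX W₂ x)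
    {e₁ e₂ : F} (he₁ : aeval e₁ (twoDivisionUCubic W₁) = 0) (he₂ : aeval e₂ (twoDivisionUCubic W₂) = 0)
    (hord₁ : IsOrdinaryAt W₁ 2) (hord₂ : IsOrdinaryAt W₂ 2) :
    IsSquare (W₁.Δ : ℚ_[2]) ↔ IsSquare (W₂.Δ : ℚ_[2]) := by
  rw [← onKilfordStratumAtTwo_iff_isSquare_padic_Δ W₁ hord₁, ← onKilfordStratumAtTwo_iff_isSquare_padic_Δ W₂ hord₂]
  exact onKilfordStratumAtTwo_iff_of_sharedCubicField W₁ W₂ hF ht₁ ht₂ he₁ he₂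

/-- **`Δ_min mod 8` agrees in the class `{1}` versus `{3,5,7}`** on the crux's good-ordinary pairs:
`Δ_min(W₁) ≡ 1 (mod 8) ↔ Δ_min(W₂) ≡ 1 (mod 8)`. (Census-checkable statement of §4 on the cell's X5 table.)
[folklore] -/
theorem minimalDiscriminantInt_emod_eight_eq_one_iff_of_sharedCubicField (hF : Module.finrank ℚ F = 3)
    (ht₁ : ∀ x : ℚ, ¬ HasRationalTwoTorsionX W₁ x) (ht₂ : ∀ x : ℚ, ¬ HasRationalTwoTorsionX W₂ x)
    {e₁ e₂ : F} (he₁ : aeval e₁ (twoDivisionUCubic W₁) = 0) (he₂ : aeval e₂ (twoDivisionUCubic W₂) = 0)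
    (hord₁ : IsOrdinaryAt W₁ 2) (hord₂ : IsOrdinaryAt W₂ 2) :
    minimalDiscriminantInt W₁ % 8 = 1 ↔ minimalDiscriminantInt W₂ % 8 = 1 := by
  rw [← onKilfordStratumAtTwo_iff_minimalDiscriminantInt_emod_eight W₁ hord₁,
    ← onKilfordStratumAtTwo_iff_minimalDiscriminantInt_emod_eight W₂ hord₂]
  exact onKilfordStratumAtTwo_iff_of_sharedCubicField W₁ W₂ hF ht₁ ht₂ he₁ he₂

end Pairs

/-! ## §7 The residual of the line in the route's vocabulary -/

section Residual

variable (W : WeierstrassCurve ℚ) [W.IsElliptic] [W.IsGloballyMinimal]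

/-- **The complement of the Buzzard locus is «ON the stratum ∪ `Δ > 0`».** For `W/ℚ` globally minimal with good ordinary
reduction at `2`: `W` is NOT in the locus `{Δ(W) < 0 ∧ Δ(W) ∉ ℚ₂²}` attacked by the line's Buzzard-multiplicity-one road
(lead att-p1 g9) iff `W` is ON the Kilford stratum or `Δ(W) > 0`. This is the sentence «what remains is the Kilford stratum ∪
the `Δ > 0` locus» (crux workfile `PICKED.md`, v22/v23 reshape) as a kernel `↔`, so the residual open stub can be binder-ed by
`OnKilfordStratumAtTwo W₁ ∨ 0 < W₁.Δ`. (`→` needs no reduction hypothesis.) [folklore] -/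
theorem onKilfordStratumAtTwo_or_Δ_pos_iff_not_buzzardLocus (hord : IsOrdinaryAt W 2) :
    (OnKilfordStratumAtTwo W ∨ 0 < W.Δ) ↔ ¬ (W.Δ < 0 ∧ ∀ s : ℚ_[2], s ^ 2 ≠ (W.Δ : ℚ_[2])) := by
  constructor
  · rintro (h | h) ⟨hneg, hsq⟩
    · exact not_onKilfordStratumAtTwo_of_forall_sq_ne W hsq h
    · exact lt_asymm hneg h
  · intro h
    by_cases hK : OnKilfordStratumAtTwo W
    · exact Or.inl hK
    · refine Or.inr ?_
      rcases lt_trichotomy W.Δ 0 with hlt | heq | hgt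
      · exact absurd ⟨hlt, forall_sq_ne_of_not_onKilfordStratumAtTwo W hord hK⟩ h
      · exact absurd heq W.isUnit_Δ.ne_zero
      · exact hgt

/-- **The Buzzard locus in the route's vocabulary**: for `W/ℚ` globally minimal with good ordinary reduction at `2`,
`(W.Δ < 0 ∧ ∀ s : ℚ_[2], s ^ 2 ≠ Δ(W)) ↔ (¬ OnKilfordStratumAtTwo W ∧ W.Δ < 0)` — i.e. the lead's g9 locus is
«OFF the stratum with negative discriminant», a sub-locus of `F1Sign2.AnalyticLineTransferAtTwoOffStratum`'s. [folklore] -/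
theorem buzzardLocus_iff_not_onKilfordStratumAtTwo_and_Δ_neg (hord : IsOrdinaryAt W 2) :
    (W.Δ < 0 ∧ ∀ s : ℚ_[2], s ^ 2 ≠ (W.Δ : ℚ_[2])) ↔ (¬ OnKilfordStratumAtTwo W ∧ W.Δ < 0) := by
  rw [not_onKilfordStratumAtTwo_iff_forall_sq_ne W hord, and_comm]

end Residual

end Summit.BirchSwinnertonDyer.BirchSwinnertonDyer.Theorems.AlignedTransportAtTwoKilfordStratumShared

end
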